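import Mathlib
import Summits.KontsevichZagierPeriods.Zeta5Search.ThirdOrderTypes
import Summits.KontsevichZagierPeriods.Zeta5Search.SecondOrderCentre
import HarnessLib

/-!
# ζ(5) search — SECOND-ORDER functionals of the odd-centre class: `ŵ₂_y = ŵ₃(T) − (L/2)ŵ₂(T)`, `v̂₂_y = v̂₃(T) − (L/2)v̂₂(T)`

Cell `pub-zeta5` (HONEST FRAMING: systematic search; no irrationality claim unless certified), typer seat generation 12.
`SecondOrderCentre.lean` (typer g11) computed the FIRST-order functionals of the self-conjugate class with the odd centre at level
`L/2` (`Φ_y = (η − L/2)Φ_T`): `ŵ_y = ŵ₂(T) − (L/2)ŵ(T)`, `v̂_y = v̂₂(T) − (L/2)v̂(T)`.  Here the same cofactor relation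
(`classRho_centre_level`) gives the SECOND-order functionals through the third-order type functionals of `ThirdOrderTypes.lean`
(REPORT-gen2-g10 §6.4 (P1), odd-centre class): `wHat2_of_rho_mul` / `vHat2_of_rho_mul` (generic, for cofactor data of `(η − c)Φ_T`) and
`wHat2_centre_level` / `vHat2_centre_level`.  Nothing here bears on irrationality.
-/

noncomputable section

open Finset PowerSeries

namespace Summit.KontsevichZagierPeriods.Zeta5Search.SecondOrder

open Summit.KontsevichZagierPeriods.Zeta5Search.CasoratianValuation (InPolytope)
open Summit.KontsevichZagierPeriods.Zeta5Search.ClusterValuation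
open Summit.KontsevichZagierPeriods.Zeta5Search.LevelClass (typeRho typeW typeV typeExp classSet_level level_injective level_mem
  classPoles_level typeW_congr typeV_congr)
open Literature.NumberTheory.Transcendental.BallRivoal (harm)

variable {p : ℕ} [hp : Fact p.Prime]

section RhoMul

variable (b : ℕ → ℤ) {x L : ℕ} (hx : x < p) (hL : x + L * p ≤ (b 0).toNat) (hL' : (b 0).toNat < x + L * p + p)
  (e : ℕ → ℤ) (he : ∀ k ≤ L, netExp b (x + k * p) = e k) (c : ℚ)
  (hrho : ∀ i ≤ L, e i < 0 → ∀ σ : ℕ, 1 ≤ σ → (σ : ℤ) ≤ -e i →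
    classRho b p (x + i * p) σ = (((i : ℕ) : ℚ) - c) * typeRho L e i σ + (if (σ : ℤ) + 1 ≤ -e i then typeRho L e i (σ + 1) else 0))
include hx hL hL' he hrho

/-- **`ŵ₂ = ŵ₃(T) − c ŵ₂(T)`** when the cofactor data are those of `(η − c)Φ_T`. -/
theorem wHat2_of_rho_mul : wHat2 b p x = typeW3 L e - c * typeW2 L e := by
  have hP : (classSet b p x).filter (fun q => netExp b q < 0) =
      ((range (L + 1)).filter fun k => e k < 0).image fun k => x + k * p := classPoles_level b hx hL hL' e he
  unfold wHat2 typeW2 typeW3 classPoles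
  rw [hP, sum_image (fun a _ c _ h => level_injective hp.out.pos x h), mul_sum, ← sum_sub_distrib]
  refine sum_congr rfl fun k hk => ?_
  obtain ⟨hkr, hkneg⟩ := mem_filter.1 hk
  have hkL : k ≤ L := by have := mem_range.1 hkr; omega
  have hρ3 : e k ≤ -3 → classRho b p (x + k * p) 3 =
      (((k : ℕ) : ℚ) - c) * typeRho L e k 3 + (if e k ≤ -4 then typeRho L e k 4 else 0) := fun h => by
    rw [hrho k hkL hkneg 3 (by norm_num) (by push_cast; omega)]
    congr 1
    split_ifs <;> first | rfl | omega
  have hρ4 : e k ≤ -4 → classRho b p (x + k * p) 4 =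
      (((k : ℕ) : ℚ) - c) * typeRho L e k 4 + (if e k ≤ -5 then typeRho L e k 5 else 0) := fun h => by
    rw [hrho k hkL hkneg 4 (by norm_num) (by push_cast; omega)]
    congr 1
    split_ifs <;> first | rfl | omega
  rw [he k hkL, level_div hx]
  by_cases h3 : e k ≤ -3
  · rw [hρ3 h3]
    by_cases h4 : e k ≤ -4
    · rw [hρ4 h4]
      split_ifs <;> first | omega | ring
    · split_ifs <;> first | omega | ring
  · split_ifs <;> first | omega | ring

/-- **`v̂₂ = v̂₃(T) − c v̂₂(T)`** when the cofactor data are those of `(η − c)Φ_T`. -/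
theorem vHat2_of_rho_mul : vHat2 b p x = typeV3 L e - c * typeV2 L e := by
  have hP : (classSet b p x).filter (fun q => netExp b q < 0) =
      ((range (L + 1)).filter fun k => e k < 0).image fun k => x + k * p := classPoles_level b hx hL hL' e he
  unfold vHat2 typeV2 typeV3 classPoles
  rw [hP, sum_image (fun a _ c _ h => level_injective hp.out.pos x h), mul_sum, ← sum_sub_distrib]
  refine sum_congr rfl fun k hk => ?_
  obtain ⟨hkr, hkneg⟩ := mem_filter.1 hk
  have hkL : k ≤ L := by have := mem_range.1 hkr; omega
  rw [he k hkL, level_div hx, mul_sum, ← sum_sub_distrib]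
  refine sum_congr rfl fun σ hσ => ?_
  have hσ' := mem_Icc.1 hσ
  have hρ1 : (σ : ℤ) + 1 ≤ -e k → classRho b p (x + k * p) (σ + 1) =
      (((k : ℕ) : ℚ) - c) * typeRho L e k (σ + 1) + (if (σ : ℤ) + 2 ≤ -e k then typeRho L e k (σ + 2) else 0) := fun h => by
    rw [hrho k hkL hkneg (σ + 1) (by omega) h]
    congr 1
  rw [hrho k hkL hkneg σ hσ'.1 (by omega)]
  by_cases hs1 : (σ : ℤ) + 1 ≤ -e k
  · rw [hρ1 hs1]
    split_ifs <;> first | omega | ring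
  · split_ifs <;> first | omega | ring

end RhoMul

section Centre

variable (b : ℕ → ℤ) {y L : ℕ} (hy : y < p) (hL : y + L * p ≤ (b 0).toNat) (hL' : (b 0).toNat < y + L * p + p)
  (hodd : ¬ (2 : ℤ) ∣ b 0) (hcen : CentreIn b p y)
include hy hL hL' hodd hcen

/-- **`ŵ₂` of the odd-centre class**: `ŵ₂_y = ŵ₃(T) − (L/2)ŵ₂(T)`. -/
theorem wHat2_centre_level (hb : InPolytope b) (e : ℕ → ℤ) (he : ∀ k ≤ L, netExp b (y + k * p) = e k) :
    wHat2 b p y = typeW3 L e - (L : ℚ) / 2 * typeW2 L e :=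
  wHat2_of_rho_mul b hy hL hL' e he _ fun _ hi hneg σ _ hσ => classRho_centre_level b hy hL hL' hodd hcen hb e he hi hneg σ hσ

/-- **`v̂₂` of the odd-centre class**: `v̂₂_y = v̂₃(T) − (L/2)v̂₂(T)`. -/
theorem vHat2_centre_level (hb : InPolytope b) (e : ℕ → ℤ) (he : ∀ k ≤ L, netExp b (y + k * p) = e k) :
    vHat2 b p y = typeV3 L e - (L : ℚ) / 2 * typeV2 L e :=
  vHat2_of_rho_mul b hy hL hL' e he _ fun _ hi hneg σ _ hσ => classRho_centre_level b hy hL hL' hodd hcen hb e he hi hneg σ hσ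

end Centre

end Summit.KontsevichZagierPeriods.Zeta5Search.SecondOrder

end
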